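import Summits.QuantumAdvantage.QuantumAdvantage.Theorems.CubicForrelationNearExactIsExactTwelveLevelSixCrossCoset

/-!
# Crux `CubicForrelation.NearExactIsExact` (stmt-QuantumAdvantage-14043) — n = 12, level ≥ 6 in the whole window top: the residual off the
  9-flat is a multiple of 8

Certificate seat `b2b-cforr-cert` (gen 13).  HONEST FRAMING: a lemma (standard axioms) for the level-`≥ 6` analysis of `(59/64, 1)` on 12 bits;
finite-slice bookkeeping, NOT summit progress.

`tw6_off_flat_lt`: cubic `f, g`, `W_g = 64u''`, `Z = {u'' even} = x_Z ⊕ V₀` 9-flat, `e = u'' − (−1)^f` with `Σ_{x ∉ Z} e² < 128`.  Then `8 ∣ e` off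
`Z`.  Round 1a (in a coset, 6-flat parity + `ws_erm_round` r = 5): `e/2` even on the coset or odd at `≥ 16` points; 1b: two bad cosets cost
`≥ 128`; 1c: for the one bad coset the CROSS-COSET localisation `tw6_cross_coset` makes the parity of `#(y ⊕ ⟨a,b,c⟩ ∩ {e/2 odd})`
independent of `y`, a covering argument makes it even, and `ws_erm_round` (r = 2) gives `≥ 128` odd points — absurd.  Round 2 (7-flat parity,
r = 6): `e/4` odd at `≥ 8` points (cost `≥ 128`) or even.  (The tree's `tw6_off_flat` needed `Σ ≤ 56` and concluded `e = 0`.)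

References: J. Ax (1964) / R. J. McEliece (1972); MacWilliams–Sloane (1977) Ch. 13 §3.  Everything below is proved from Mathlib and the
tree; axioms are the standard three.
-/

set_option linter.dupNamespace false -- D-0017: single-problem summit ⇒ `QuantumAdvantage.QuantumAdvantage` by design

noncomputable section

namespace Summit.QuantumAdvantage.QuantumAdvantage.Theorems.CubicForrelation.NearExactIsExact

open Finset
open Literature.Computability.QuantumComplexity
open Literature.Computability.QuantumComplexity.BuzetChailloux (bxor zeroVec bxor_bxor_cancel_left bxor_zeroVec zeroVec_bxor bxor_comm
  bxor_self)
open Literature.Computability.QuantumComplexity.DerivativeWalsh (W)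

/-! ### The residual off the 9-flat -/

/-- **Off the flat the residual is a multiple of 8.**  Cubic `f, g` on 12 bits with `W_g = 64u''`; `Z = {u'' even}` a coset
`x_Z ⊕ V₀` of an xor-closed `V₀ ∋ 0` with `2⁹` elements; if `e = u'' − (−1)^f` has `Σ_{x ∉ Z} e(x)² < 128` then `8 ∣ e` off `Z`. [this work] -/
theorem tw6_off_flat_lt (f g : (Fin (6 + 6) → Bool) → Bool) (hf : IsDegLeFun 3 f) (hg : IsDegLeFun 3 g)
    (u'' : (Fin (6 + 6) → Bool) → ℤ) (hu'' : ∀ x, W (fun y => signOf (g y)) x = (2 : ℝ) ^ 6 * (u'' x : ℝ))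
    (V₀ : Finset (Fin (6 + 6) → Bool)) (xZ : Fin (6 + 6) → Bool) (h0 : zeroVec ∈ V₀)
    (hadd : ∀ a ∈ V₀, ∀ b ∈ V₀, bxor a b ∈ V₀) (hcardV9 : #V₀ = 2 ^ 9)
    (hS : (univ.filter fun x : Fin (6 + 6) → Bool => ¬ Odd (u'' x)) = V₀.image (bxor xZ))
    (hoff_lt : ∑ x ∈ univ.filter (fun x => x ∉ (univ.filter fun x : Fin (6 + 6) → Bool => ¬ Odd (u'' x))),
      (u'' x - sZ (f x)) ^ 2 < 128) :
    ∀ y, y ∉ (univ.filter fun x : Fin (6 + 6) → Bool => ¬ Odd (u'' x)) → (8 : ℤ) ∣ u'' y - sZ (f y) := by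
  classical
  set Z := univ.filter (fun x : Fin (6 + 6) → Bool => ¬ Odd (u'' x)) with hZdef
  have hmemZ : ∀ x, x ∈ Z ↔ ¬ Odd (u'' x) := fun x => by simp [hZdef]
  set u : (Fin (6 + 6) → Bool) → ℤ := fun x => 4 * u'' x with hudef
  have hu : ∀ x, W (fun y => signOf (g y)) x = (2 : ℝ) ^ 4 * (u x : ℝ) := by
    intro x; rw [hu'' x]; simp only [u]; push_cast; ring
  set e : (Fin (6 + 6) → Bool) → ℤ := fun x => u'' x - sZ (f x) with hedef
  show ∀ y, y ∉ Z → (8 : ℤ) ∣ e y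
  have hFe : ∀ y, u y - 4 * sZ (f y) = 4 * e y := fun y => by simp only [u, e]; ring
  have heeven : ∀ x, x ∉ Z → Even (e x) := by
    intro x hx
    have hodd : Odd (u'' x) := not_not.1 fun h => hx ((hmemZ x).2 h)
    rcases tp_sZ_cases (f x) with hs | hs <;> simp only [e] <;> rw [hs]
    · exact Int.even_sub.2 (iff_of_false (Int.not_even_iff_odd.2 hodd) (by decide))
    · exact Int.even_sub.2 (iff_of_false (Int.not_even_iff_odd.2 hodd) (by decide))
  have hPV' : ∀ x, x ∉ Z → ∀ a ∈ V₀, bxor x a ∉ Z := fun x hx a ha => fl1_coset_out' hadd hS hx ha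

  -- flat sums of `4e = u − 4s`: `16 ∣` on 6-flats, `32 ∣` on 7-flats
  have hflat6 : ∀ (b : Fin (6 + 6) → Bool) (a : Fin 6 → Fin (6 + 6) → Bool),
      (4 : ℤ) ∣ ∑ ε : Fin 6 → Bool, e (fun j => b j ^^ decide (Odd #(univ.filter fun i => ε i && a i j))) := by
    intro b a
    have h1 := fs_flat_sum_dvd (e := 4) g u hg hu b a (by norm_num)
    obtain ⟨zf, hzf⟩ := sl_sum_sZ_flat f hf b a
    have hzf' : ∑ ε : Fin 6 → Bool, 4 * sZ (f (fun j => b j ^^ decide (Odd #(univ.filter fun i => ε i && a i j)))) = 16 * zf := by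
      rw [← mul_sum, hzf]; norm_num; ring
    have h1' : (16 : ℤ) ∣ ∑ ε : Fin 6 → Bool, u (fun j => b j ^^ decide (Odd #(univ.filter fun i => ε i && a i j))) := by
      have e16 : (2 : ℤ) ^ 4 = 16 := by norm_num
      rw [e16] at h1; exact h1
    have h2 : (16 : ℤ) ∣ ∑ ε : Fin 6 → Bool, (u (fun j => b j ^^ decide (Odd #(univ.filter fun i => ε i && a i j))) -
        4 * sZ (f (fun j => b j ^^ decide (Odd #(univ.filter fun i => ε i && a i j))))) := by
      rw [sum_sub_distrib, hzf']
      exact dvd_sub h1' (Dvd.intro _ rfl)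
    have h3 : ∑ ε : Fin 6 → Bool, (u (fun j => b j ^^ decide (Odd #(univ.filter fun i => ε i && a i j))) -
        4 * sZ (f (fun j => b j ^^ decide (Odd #(univ.filter fun i => ε i && a i j))))) =
        4 * ∑ ε : Fin 6 → Bool, e (fun j => b j ^^ decide (Odd #(univ.filter fun i => ε i && a i j))) := by
      rw [mul_sum]; exact sum_congr rfl fun ε _ => hFe _
    rw [h3] at h2
    obtain ⟨k, hk⟩ := h2
    exact ⟨k, by linarith⟩
  have hflat7 : ∀ (b : Fin (6 + 6) → Bool) (a : Fin 7 → Fin (6 + 6) → Bool),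
      (8 : ℤ) ∣ ∑ ε : Fin 7 → Bool, e (fun j => b j ^^ decide (Odd #(univ.filter fun i => ε i && a i j))) := by
    intro b a
    have h1 := fs_flat_sum_dvd (e := 5) g u hg hu b a (by norm_num)
    obtain ⟨zf, hzf⟩ := sl_sum_sZ_flat f hf b a
    have hzf' : ∑ ε : Fin 7 → Bool, 4 * sZ (f (fun j => b j ^^ decide (Odd #(univ.filter fun i => ε i && a i j)))) = 32 * zf := by
      rw [← mul_sum, hzf]; norm_num; ring
    have h1' : (32 : ℤ) ∣ ∑ ε : Fin 7 → Bool, u (fun j => b j ^^ decide (Odd #(univ.filter fun i => ε i && a i j))) := by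
      have e32 : (2 : ℤ) ^ 5 = 32 := by norm_num
      rw [e32] at h1; exact h1
    have h2 : (32 : ℤ) ∣ ∑ ε : Fin 7 → Bool, (u (fun j => b j ^^ decide (Odd #(univ.filter fun i => ε i && a i j))) -
        4 * sZ (f (fun j => b j ^^ decide (Odd #(univ.filter fun i => ε i && a i j))))) := by
      rw [sum_sub_distrib, hzf']
      exact dvd_sub h1' (Dvd.intro _ rfl)
    have h3 : ∑ ε : Fin 7 → Bool, (u (fun j => b j ^^ decide (Odd #(univ.filter fun i => ε i && a i j))) -
        4 * sZ (f (fun j => b j ^^ decide (Odd #(univ.filter fun i => ε i && a i j))))) =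
        4 * ∑ ε : Fin 7 → Bool, e (fun j => b j ^^ decide (Odd #(univ.filter fun i => ε i && a i j))) := by
      rw [mul_sum]; exact sum_congr rfl fun ε _ => hFe _
    rw [h3] at h2
    obtain ⟨k, hk⟩ := h2
    exact ⟨k, by linarith⟩
  -- OFF-Z KILL, round 1: `4 ∣ e` off `Z`
  have hcos_out : ∀ p, p ∉ Z → ∀ b ∈ V₀.image (bxor p), b ∉ Z := by
    intro p hp b hb
    obtain ⟨v, hv, rfl⟩ := mem_image.1 hb
    exact hPV' p hp v hv
  have hoff_count : ∀ (T : Finset (Fin (6 + 6) → Bool)) (c : ℤ), (∀ x ∈ T, x ∉ Z) → (∀ x ∈ T, c ≤ e x ^ 2) →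
      c * #T < 128 := by
    intro T c hT hc
    calc c * #T = ∑ x ∈ T, c := by rw [sum_const, nsmul_eq_mul, mul_comm]
      _ ≤ ∑ x ∈ T, e x ^ 2 := sum_le_sum hc
      _ ≤ ∑ x ∈ univ.filter (fun x => x ∉ Z), e x ^ 2 :=
          sum_le_sum_of_subset_of_nonneg (fun x hx => mem_filter.2 ⟨mem_univ _, hT x hx⟩) fun x _ _ => sq_nonneg _
      _ < 128 := hoff_lt
  have hxZ : xZ ∈ Z := by rw [hS]; exact mem_image.2 ⟨zeroVec, h0, bxor_zeroVec xZ⟩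
  have hPV : ∀ x, x ∈ Z → ∀ a ∈ V₀, bxor x a ∈ Z := fun x hx a ha => fl1_coset_vadd hadd hS hx ha
  have hp2 : ∀ y, y ∉ Z → e y = 2 * (e y / 2) := fun y hy =>
    (Int.mul_ediv_cancel' (even_iff_two_dvd.1 (heeven y hy))).symm
  have hcost4 : ∀ x, x ∉ Z → Odd (e x / 2) → 4 ≤ e x ^ 2 := by
    intro x hx hodd
    have h0' := Int.odd_iff.1 hodd
    have h2 := hp2 x hx
    have : e x ≤ -2 ∨ 2 ≤ e x := by omega
    have := tp_sq_ge (k := 2) (by norm_num) this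
    linarith
  -- round 1a: in a coset `p ⊕ V₀` (`p ∉ Z`) `e/2` is even, or odd at `≥ 16` points (6-flat parity + Reed–Muller on the abstract flat)
  have hdich : ∀ p, p ∉ Z → (∀ x ∈ V₀.image (bxor p), Even (e x / 2)) ∨
      16 ≤ #((V₀.image (bxor p)).filter fun x => Odd (e x / 2)) := by
    intro p hp
    rcases ws_erm_round V₀ h0 hadd hcardV9 p (fun y => e y / 2) 5 (fun b hb a ha => by
        have hpts : ∀ ε : Fin (5 + 1) → Bool, (fun j => b j ^^ decide (Odd #(univ.filter fun i => ε i && a i j))) ∉ Z :=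
          fun ε => ws_flatPt_mem V₀ h0 (· ∉ Z) hPV' (5 + 1) b (hcos_out p hp b hb) a ha ε
        have h4 := hflat6 b a
        rw [sum_congr rfl fun ε _ => hp2 _ (hpts ε), ← mul_sum] at h4
        obtain ⟨k, hk⟩ := h4
        exact ⟨k, by linarith⟩) with hev | hbig
    · exact Or.inl hev
    · right; norm_num at hbig; omega
  have hbad_of_odd : ∀ p, p ∉ Z → Odd (e p / 2) → 16 ≤ #((V₀.image (bxor p)).filter fun x => Odd (e x / 2)) := by
    intro p hp hpodd
    refine (hdich p hp).resolve_left fun h => ?_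
    exact (Int.not_even_iff_odd.2 hpodd) (h p (mem_image.2 ⟨zeroVec, h0, bxor_zeroVec p⟩))
  -- round 1b: two distinct bad cosets would cost `≥ 128`
  have hone : ∀ p, p ∉ Z → Odd (e p / 2) → ∀ z, z ∉ Z → z ∉ V₀.image (bxor p) → Even (e z / 2) := by
    intro p hp hpodd z hz hzC
    by_contra hzodd
    rw [Int.not_even_iff_odd] at hzodd
    have hCp := hbad_of_odd p hp hpodd
    have hCz := hbad_of_odd z hz hzodd
    have hdisj : Disjoint ((V₀.image (bxor p)).filter fun x => Odd (e x / 2)) ((V₀.image (bxor z)).filter fun x => Odd (e x / 2)) := by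
      rw [disjoint_left]
      intro x hxp hxz
      apply hzC
      obtain ⟨v, hv, hvx⟩ := mem_image.1 (mem_filter.1 hxp).1
      obtain ⟨v', hv', hv'x⟩ := mem_image.1 (mem_filter.1 hxz).1
      refine mem_image.2 ⟨bxor v v', hadd v hv v' hv', ?_⟩
      rw [← iw_bxor_assoc, hvx, ← hv'x, iw_bxor_assoc, bxor_self, bxor_zeroVec]
    have hsum := hoff_count (((V₀.image (bxor p)).filter fun x => Odd (e x / 2)) ∪
        ((V₀.image (bxor z)).filter fun x => Odd (e x / 2))) 4
      (fun x hx => by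
        rcases mem_union.1 hx with h | h
        · exact hcos_out p hp x (mem_filter.1 h).1
        · exact hcos_out z hz x (mem_filter.1 h).1)
      (fun x hx => by
        rcases mem_union.1 hx with h | h
        · exact hcost4 x (hcos_out p hp x (mem_filter.1 h).1) (mem_filter.1 h).2
        · exact hcost4 x (hcos_out z hz x (mem_filter.1 h).1) (mem_filter.1 h).2)
    rw [card_union_of_disjoint hdisj] at hsum
    push_cast at hsum
    have h16p : (16 : ℤ) ≤ #((V₀.image (bxor p)).filter fun x => Odd (e x / 2)) := by exact_mod_cast hCp
    have h16z : (16 : ℤ) ≤ #((V₀.image (bxor z)).filter fun x => Odd (e x / 2)) := by exact_mod_cast hCz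
    linarith
  -- round 1c: a bad coset is impossible — CROSS-COSET localisation, covering, Reed–Muller on the abstract flat
  have hdiv4 : ∀ y, y ∉ Z → (4 : ℤ) ∣ e y := by
    by_contra hcon
    push Not at hcon
    obtain ⟨p, hp, hp4⟩ := hcon
    have hpodd : Odd (e p / 2) := by
      rw [← Int.not_even_iff_odd]; rintro ⟨k, hk⟩; exact hp4 ⟨k, by rw [hp2 p hp, hk]; ring⟩
    have hbad := hbad_of_odd p hp hpodd
    have hbad_lt : #((V₀.image (bxor p)).filter fun x => Odd (e x / 2)) < 32 := by
      have h := hoff_count ((V₀.image (bxor p)).filter fun x => Odd (e x / 2)) 4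
        (fun x hx => hcos_out p hp x (mem_filter.1 hx).1)
        (fun x hx => hcost4 x (hcos_out p hp x (mem_filter.1 hx).1) (mem_filter.1 hx).2)
      have : (#((V₀.image (bxor p)).filter fun x => Odd (e x / 2)) : ℤ) < 32 := by linarith
      exact_mod_cast this
    -- `4 ∣ e` outside `Z ∪ (y ⊕ V₀)` for every `y` in the bad coset
    have hout4 : ∀ y, y ∈ V₀.image (bxor p) → ∀ z, z ∉ Z → bxor z (bxor xZ y) ∉ Z → (4 : ℤ) ∣ e z := by
      intro y hy z hz hzw
      have hzC : z ∉ V₀.image (bxor p) := by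
        intro hzC
        apply hzw
        obtain ⟨v, hv, rfl⟩ := mem_image.1 hzC
        obtain ⟨v', hv', rfl⟩ := mem_image.1 hy
        have e2 : bxor (bxor p v) (bxor xZ (bxor p v')) = bxor xZ (bxor v v') := by
          funext j; simp only [bxor]; cases p j <;> cases v j <;> cases xZ j <;> cases v' j <;> rfl
        rw [e2]; exact hPV _ hxZ _ (hadd v hv v' hv')
      obtain ⟨k, hk⟩ := hone p hp hpodd z hz hzC
      exact ⟨k, by rw [hp2 z hz, hk]; ring⟩
    -- the 3-flat parity `N(y)` is constant mod 2 over the bad coset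
    have hkey : ∀ y, y ∈ V₀.image (bxor p) → ∀ a : Fin 3 → Fin (6 + 6) → Bool, (∀ i, a i ∈ V₀) →
        (4 : ℤ) ∣ ∑ ε : Fin 3 → Bool, e (fun j => xZ j ^^ decide (Odd #(univ.filter fun i => ε i && a i j))) +
          2 * #((univ : Finset (Fin 3 → Bool)).filter fun ε =>
            Odd (e (fun j => y j ^^ decide (Odd #(univ.filter fun i => ε i && a i j))) / 2)) := by
      intro y hy a ha
      have ea : a = ![a 0, a 1, a 2] := by funext i; fin_cases i <;> rfl
      have h := tw6_cross_coset f g hf hg u'' hu'' V₀ xZ h0 hadd hcardV9 hS y (hcos_out p hp y hy) (hout4 y hy) (ha 0) (ha 1) (ha 2)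
      rw [← ea] at h
      -- `Σ_{y-flat} e ≡ 2·N(y) (mod 4)`
      have hpts : ∀ ε : Fin 3 → Bool, (fun j => y j ^^ decide (Odd #(univ.filter fun i => ε i && a i j))) ∉ Z :=
        fun ε => ws_flatPt_mem V₀ h0 (· ∉ Z) hPV' 3 y (hcos_out p hp y hy) a ha ε
      have hterm : ∀ ε : Fin 3 → Bool, (4 : ℤ) ∣ e (fun j => y j ^^ decide (Odd #(univ.filter fun i => ε i && a i j))) -
          2 * (if Odd (e (fun j => y j ^^ decide (Odd #(univ.filter fun i => ε i && a i j))) / 2) then 1 else 0) := by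
        intro ε
        have h2 := hp2 _ (hpts ε)
        by_cases ho : Odd (e (fun j => y j ^^ decide (Odd #(univ.filter fun i => ε i && a i j))) / 2)
        · rw [if_pos ho]; have := Int.odd_iff.1 ho; omega
        · rw [if_neg ho]; have := Int.even_iff.1 (Int.not_odd_iff_even.1 ho); omega
      have hsum4 : (4 : ℤ) ∣ ∑ ε : Fin 3 → Bool, (e (fun j => y j ^^ decide (Odd #(univ.filter fun i => ε i && a i j))) -
          2 * (if Odd (e (fun j => y j ^^ decide (Odd #(univ.filter fun i => ε i && a i j))) / 2) then 1 else 0)) :=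
        dvd_sum fun ε _ => hterm ε
      rw [sum_sub_distrib, ← mul_sum, sum_boole] at hsum4
      push_cast at hsum4
      obtain ⟨k1, hk1⟩ := h
      obtain ⟨k2, hk2⟩ := hsum4
      exact ⟨k1 - k2, by linarith⟩
    have hpar : ∀ y, y ∈ V₀.image (bxor p) → ∀ y', y' ∈ V₀.image (bxor p) → ∀ a : Fin 3 → Fin (6 + 6) → Bool, (∀ i, a i ∈ V₀) →
        (Even #((univ : Finset (Fin 3 → Bool)).filter fun ε =>
            Odd (e (fun j => y j ^^ decide (Odd #(univ.filter fun i => ε i && a i j))) / 2)) ↔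
         Even #((univ : Finset (Fin 3 → Bool)).filter fun ε =>
            Odd (e (fun j => y' j ^^ decide (Odd #(univ.filter fun i => ε i && a i j))) / 2))) := by
      intro y hy y' hy' a ha
      obtain ⟨k1, hk1⟩ := hkey y hy a ha
      obtain ⟨k2, hk2⟩ := hkey y' hy' a ha
      rw [Nat.even_iff, Nat.even_iff]
      omega
    -- if odd somewhere, the coset is covered by 8 translates of the bad set: `512 ≤ 8·31`
    have heven3 : ∀ y, y ∈ V₀.image (bxor p) → ∀ a : Fin 3 → Fin (6 + 6) → Bool, (∀ i, a i ∈ V₀) →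
        Even #((univ : Finset (Fin 3 → Bool)).filter fun ε =>
            Odd (e (fun j => y j ^^ decide (Odd #(univ.filter fun i => ε i && a i j))) / 2)) := by
      intro y hy a ha
      by_contra hodd
      have hall : ∀ y', y' ∈ V₀.image (bxor p) → ∃ ε : Fin 3 → Bool,
          Odd (e (fun j => y' j ^^ decide (Odd #(univ.filter fun i => ε i && a i j))) / 2) := by
        intro y' hy'
        have hodd' : ¬ Even #((univ : Finset (Fin 3 → Bool)).filter fun ε =>
            Odd (e (fun j => y' j ^^ decide (Odd #(univ.filter fun i => ε i && a i j))) / 2)) :=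
          fun h' => hodd ((hpar y hy y' hy' a ha).2 h')
        by_contra hnone
        push Not at hnone
        apply hodd'
        rw [filter_false_of_mem (fun ε _ => hnone ε), card_empty]
        exact ⟨0, rfl⟩
      have hv : ∀ ε : Fin 3 → Bool, (fun j => zeroVec j ^^ decide (Odd #(univ.filter fun i => ε i && a i j))) ∈ V₀ :=
        fun ε => ws_flatPt_mem V₀ h0 (· ∈ V₀) (fun x hx b hb' => hadd x hx b hb') 3 zeroVec h0 a ha ε
      have hcover : V₀.image (bxor p) ⊆ (univ : Finset (Fin 3 → Bool)).biUnion (fun ε => (V₀.image (bxor p)).filter fun y' =>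
          Odd (e (bxor y' (fun j => zeroVec j ^^ decide (Odd #(univ.filter fun i => ε i && a i j)))) / 2)) := by
        intro y' hy'
        obtain ⟨ε, hε⟩ := hall y' hy'
        rw [ws_flatPt_eq_bxor] at hε
        exact mem_biUnion.2 ⟨ε, mem_univ _, mem_filter.2 ⟨hy', hε⟩⟩
      have hcard := (card_le_card hcover).trans card_biUnion_le
      rw [sum_congr rfl fun ε _ => ws_card_translate V₀ (V₀.image (bxor p)) p hadd rfl (hv ε) (fun y' => Odd (e y' / 2)),
        sum_const, card_univ, Fintype.card_fun, Fintype.card_bool, Fintype.card_fin, smul_eq_mul] at hcard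
      have hC : #(V₀.image (bxor p)) = 512 := by
        rw [card_image_of_injective _ (fun a b h => by simpa using congrArg (bxor p) h), hcardV9]; norm_num
      rw [hC] at hcard
      have : #((V₀.image (bxor p)).filter fun y' => Odd (e y' / 2)) < 32 := hbad_lt
      omega
    -- Reed–Muller (r = 2) on the bad coset: `≥ 128` odd points, or none — both absurd
    rcases ws_erm_round V₀ h0 hadd hcardV9 p (fun z => e z / 2) 2 (fun b hb a ha =>
        even_iff_two_dvd.1 ((tw_even_sum_iff univ (fun ε : Fin (2 + 1) → Bool =>
          e (fun j => b j ^^ decide (Odd #(univ.filter fun i => ε i && a i j))) / 2)).2 (heven3 b hb a ha))) with hev | hbig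
    · exact (Int.not_even_iff_odd.2 hpodd) (hev p (mem_image.2 ⟨zeroVec, h0, bxor_zeroVec p⟩))
    · norm_num at hbig
      omega
  -- round 2: `8 ∣ e` off `Z`
  have hdiv8 : ∀ y, y ∉ Z → (8 : ℤ) ∣ e y := by
    by_contra hcon
    push Not at hcon
    obtain ⟨p, hp, hp8⟩ := hcon
    have hp4 : ∀ y, y ∉ Z → e y = 4 * (e y / 4) := fun y hy => (Int.mul_ediv_cancel' (hdiv4 y hy)).symm
    rcases ws_erm_round V₀ h0 hadd hcardV9 p (fun y => e y / 4) 6 (fun b hb a ha => by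
        have hpts : ∀ ε : Fin (6 + 1) → Bool, (fun j => b j ^^ decide (Odd #(univ.filter fun i => ε i && a i j))) ∉ Z :=
          fun ε => ws_flatPt_mem V₀ h0 (· ∉ Z) hPV' (6 + 1) b (hcos_out p hp b hb) a ha ε
        have h8 := hflat7 b a
        rw [sum_congr rfl fun ε _ => hp4 _ (hpts ε), ← mul_sum] at h8
        obtain ⟨k, hk⟩ := h8
        exact ⟨k, by linarith⟩) with hev | hbig
    · have := hev p (mem_image.2 ⟨zeroVec, h0, bxor_zeroVec p⟩)
      apply hp8
      obtain ⟨k, hk⟩ := this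
      exact ⟨k, by rw [hp4 p hp, hk]; ring⟩
    · have hT := hoff_count ((V₀.image (bxor p)).filter fun x => Odd (e x / 4)) 16
        (fun x hx => hcos_out p hp x (mem_filter.1 hx).1) (fun x hx => by
          have hx' := (mem_filter.1 hx)
          have hxZ : x ∉ Z := hcos_out p hp x hx'.1
          have h0' := Int.odd_iff.1 hx'.2
          have h2 := hp4 x hxZ
          have : e x ≤ -4 ∨ 4 ≤ e x := by omega
          have := tp_sq_ge (k := 4) (by norm_num) this
          linarith)
      norm_num at hbig
      have : (8 : ℤ) ≤ #((V₀.image (bxor p)).filter fun x => Odd (e x / 4)) := by exact_mod_cast (by omega)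
      linarith
  exact hdiv8

end Summit.QuantumAdvantage.QuantumAdvantage.Theorems.CubicForrelation.NearExactIsExact

end
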